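import Summits.AtomisticToContinuum.BoseEinsteinCondensation.Theses.BECConjugateDomination

/-!
# Ideator sketch (crux-ideate round 1, ideator 3) — crux `HardCoreExtension`
(stmt-AtomisticToContinuum-11786, route BECConjugateDomination)

First-lemma signatures for the two idea cards

* `second-moment-floor` : `SecondMomentFloor` (provable now: Cauchy–Schwarz + the f-sum identity by
  integration by parts on the torus), `QuadraticFloor` (the class-blind replacement of `PuffFloor`,
  crux-strength), `LatticeInvSqSum` (the `d = 3` margin of the glue: `∑_{0<|m|≤M} |m|⁻² ≤ C (M+1)`).
* `earned-uniformity-monotone-limit` : `MonotoneFormContinuity` (fixed-`(N,L)` monotone convergence of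
  the periodic ground-state energy, Simon's theorem in variational clothes), `UniformSmoothPeriodicBEC`
  (the scale-free form of the route's target on the smooth class: constants depend on `v` only through a
  bound `a₀` on the scattering length and the range `R₀`), `MonotoneLimitTransfer` (the fixed-`(N,L)`
  passage from uniform minimiser-BEC along `w_i ↑ v` to all near-minimisers of `v`).

Nothing here is proved; every `def` is a `Prop` over existing declarations and must only elaborate.
-/

namespace Summit.AtomisticToContinuum.BoseEinsteinCondensation.Cruxes.HardCoreExtension.Ideator3

open scoped BigOperators ENNReal
open Filter MeasureTheory
open Literature.MathematicalPhysics.QuantumManyBody.BoseGas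

/-- (card `second-moment-floor`, first lemma, provable now) **Chebyshev/second-moment floor**:
for a real non-negative periodic `C¹` state of `N = n+1` bosons and every `m ≠ 0`, with
`k = 2πm/L`, `S_m = N⁻¹∫|ρ̂_k|²|Ψ|²` and the KINETIC second moment
`M₂(m) = N⁻¹ ∫ |∑_j e^{ik·x_j}(|k|²Ψ - 2i k·∇_jΨ)|²` (`= N⁻¹‖[T, ρ̂_k]Ψ‖²`; the pair potential never
enters), one has `|k|⁴ ≤ S_m · M₂(m)`. Proof: `Re⟨ρ̂_kΨ, [T,ρ̂_k]Ψ⟩ = N|k|²` (f-sum identity, by parts,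
`Ψ` real) and Cauchy–Schwarz. -/
def SecondMomentFloor : Prop :=
  ∀ (n : ℕ) (L : ℝ), 0 < L → ∀ Ψ : PeriodicTrialState (n + 1) L,
    (∀ X, Ψ.ψ X = (‖Ψ.ψ X‖ : ℂ)) →
    ∀ m : Fin 3 → ℤ, m ≠ 0 →
      (let k : Space := (2 * Real.pi / L) • latticeVec 1 m
       let S : ℝ := ((n : ℝ) + 1)⁻¹ *
         ∫ X in cellN (n + 1) L, ‖∑ j : Fin (n + 1), cellWave L m (X j)‖ ^ 2 * ‖Ψ.ψ X‖ ^ 2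
       let M₂ : ℝ := ((n : ℝ) + 1)⁻¹ *
         ∫ X in cellN (n + 1) L,
           ‖∑ j : Fin (n + 1), cellWave L m (X j) *
               (((‖k‖ ^ 2 : ℝ) : ℂ) * Ψ.ψ X -
                 2 * Complex.I * fderiv ℝ Ψ.ψ X (Pi.single j k))‖ ^ 2
       ‖k‖ ^ 4 ≤ S * M₂)

/-- (card `second-moment-floor`, the crux-strength stub replacing `PuffFloor`) **class-blind quadratic
floor**: for EVERY repulsive finite-range `v` (hard cores, `+∞`, kinks allowed) there are `C ≥ 0`,
`ρ₀ > 0` such that for `0 < ρ < ρ₀`, all large `N` and some tolerance `δ > 0`, every real non-negative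
`δ`-near-minimiser on the torus of side `(N/ρ)^{1/3}` has `S_m ≥ |k|²/(|k|² + Cρ)` for all `m ≠ 0`.
By `SecondMomentFloor` it follows from the current-fluctuation bound `M₂(m) ≤ |k|²(|k|² + Cρ)`, i.e.
`N⁻¹‖J_kΨ‖² ≤ C'ρ|k|²` for the longitudinal current `J_k = ∑_j e^{ik·x_j} k·∇_j`.
(Bogoliubov: `M₂ = |k|³(|k|²+16πρa)^{1/2} ≤ |k|⁴ + 8πρa|k|²`.) -/
def QuadraticFloor : Prop :=
  ∀ v : ℝ → ℝ≥0∞, IsRepulsiveFiniteRange v →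
    ∃ C : ℝ, 0 ≤ C ∧ ∃ ρ₀ : ℝ, 0 < ρ₀ ∧ ∀ ρ : ℝ, 0 < ρ → ρ < ρ₀ →
      ∀ᶠ n : ℕ in atTop, ∃ δ : ℝ≥0∞, 0 < δ ∧
        ∀ Ψ : PeriodicTrialState (n + 1) (sideLength ρ (n + 1)),
          (let L : ℝ := sideLength ρ (n + 1)
           let S : (Fin 3 → ℤ) → ℝ := fun m => ((n : ℝ) + 1)⁻¹ *
             ∫ X in cellN (n + 1) L, ‖∑ j : Fin (n + 1), cellWave L m (X j)‖ ^ 2 * ‖Ψ.ψ X‖ ^ 2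
           let kn : (Fin 3 → ℤ) → ℝ := fun m => ‖((2 * Real.pi / L) • latticeVec 1 m)‖
           periodicEnergy v Ψ ≤ periodicGroundStateEnergy v (n + 1) L + δ →
           periodicEnergy v Ψ ≠ ⊤ →
           (∀ X, Ψ.ψ X = (‖Ψ.ψ X‖ : ℂ)) →
           ∀ m : Fin 3 → ℤ, m ≠ 0 → kn m ^ 2 / (kn m ^ 2 + C * ρ) ≤ S m)

/-- (card `second-moment-floor`, the `d = 3` margin of `IMUChainGlue`, provable now) the lattice sum
that the quadratic floor feeds into step (v) of the glue is LINEAR in the cutoff: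
`∑_{m ∈ ℤ³, 0 < |m| ≤ M} |m|⁻² ≤ C (M + 1)` (shell counting `#{|m| ≈ j} ≍ j²`; in `d = 2` it would be
`log M`, in `d = 1` bounded — the dimension enters exactly here). -/
def LatticeInvSqSum : Prop :=
  ∃ C : ℝ, ∀ M : ℕ,
    ∑ m ∈ Fintype.piFinset (fun _ : Fin 3 => Finset.Icc (-(M : ℤ)) M),
      (if m = 0 then (0 : ℝ) else (‖latticeVec 1 m‖ ^ 2)⁻¹) ≤ C * ((M : ℝ) + 1)

/-- (card `earned-uniformity-monotone-limit`, first lemma) **monotone form continuity at fixed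
`(N, L)`**: if measurable potentials `w_i ↑ v` pointwise then the periodic ground-state energies
(infima over the `C¹` periodic Bose class) converge: `E₀(v; N, L) = sup_i E₀(w_i; N, L)`.
`≥` is monotonicity of `periodicEnergy` in the potential; `≤` is Simon's monotone convergence theorem
for closed forms plus Rellich compactness on the torus and density of the `C¹` core in the limit form
domain (Hedberg's synthesis for the hard set). -/
def MonotoneFormContinuity : Prop :=
  ∀ (w : ℕ → ℝ → ℝ≥0∞) (v : ℝ → ℝ≥0∞), (∀ i, Measurable (w i)) → Measurable v →
    (∀ i r, w i r ≤ w (i + 1) r) → (∀ r, ⨆ i, w i r = v r) →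
    ∀ (N : ℕ) (L : ℝ), 0 < L →
      periodicGroundStateEnergy v N L = ⨆ i, periodicGroundStateEnergy (w i) N L

/-- (card `earned-uniformity-monotone-limit`, the scale-free form of the route's smooth-class target)
**uniform smooth-class minimiser BEC**: the constants `ρ₀, c, N₀` depend on a smooth-class `v` only
through a bound `a₀` on its scattering length and its range `R₀` (what the chain
`IMU ∧ QuadraticFloor ∧ glue` delivers once `‖ṽ‖₁` is replaced by `8πa` via LSSY Thm 2.2 and Puff's
`m₃` by `M₂`): for every minimiser, `n₀ ≥ cN`. -/
def UniformSmoothPeriodicBEC : Prop :=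
  ∀ a₀ R₀ : ℝ, 0 < a₀ → a₀ ≤ R₀ →
    ∃ ρ₀ : ℝ, 0 < ρ₀ ∧ ∀ ρ : ℝ, 0 < ρ → ρ < ρ₀ → ∃ c : ℝ, 0 < c ∧ ∀ᶠ N : ℕ in atTop,
      ∀ v : ℝ → ℝ≥0∞, IsRepulsiveFiniteRange v → (∀ r, v r ≠ ⊤) →
        ContDiff ℝ 2 (fun x : Space => (v ‖x‖).toReal) →
        (∃ Cₑ : ℝ, ∀ x : Space, ‖iteratedFDeriv ℝ 2 (fun x : Space => (v ‖x‖).toReal) x‖ ≤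
            Cₑ * Real.sqrt ((v ‖x‖).toReal)) →
        scatteringLength v ≤ ENNReal.ofReal a₀ → (∀ r, R₀ < r → v r = 0) →
        ∀ Ψ : PeriodicTrialState N (sideLength ρ N),
          periodicEnergy v Ψ = periodicGroundStateEnergy v N (sideLength ρ N) →
          periodicEnergy v Ψ ≠ ⊤ →
          ENNReal.ofReal (c * N) ≤ condensateOccupation N (sideLength ρ N) Ψ.ψ

/-- (card `earned-uniformity-monotone-limit`, fixed-`(N,L)` transfer schema) **minimiser-BEC along a
monotone approximation passes to the near-minimisers of the limit**: if `w_i ↑ v`, the limit energy is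
finite, each `w_i` has a minimiser in the class, and every minimiser of every `w_i` has `n₀ ≥ cN`,
then for every `ε > 0` some tolerance `δ > 0` makes every `δ`-near-minimiser of `v` have
`n₀ ≥ (c - ε)N`. (Γ-liminf + Rellich at fixed `N` give an `L²`-limit of the `w_i`-minimisers which is
the form-ground state of `v`; `n₀` is `2N`-Lipschitz in `L²`; Courant's two-dimensional min-max gives
near-minimiser stability from the fixed-`N` gap of `v`, itself the limit of the gaps of `w_i`.) -/
def MonotoneLimitTransfer : Prop :=
  ∀ (w : ℕ → ℝ → ℝ≥0∞) (v : ℝ → ℝ≥0∞), (∀ i, Measurable (w i)) → Measurable v →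
    (∀ i r, w i r ≤ w (i + 1) r) → (∀ r, ⨆ i, w i r = v r) →
    ∀ (N : ℕ) (L : ℝ), 0 < L → periodicGroundStateEnergy v N L ≠ ⊤ →
      (∀ i, ∃ Ψ : PeriodicTrialState N L, periodicEnergy (w i) Ψ = periodicGroundStateEnergy (w i) N L) →
      ∀ c : ℝ,
        (∀ i, ∀ Ψ : PeriodicTrialState N L,
            periodicEnergy (w i) Ψ = periodicGroundStateEnergy (w i) N L →
            ENNReal.ofReal (c * N) ≤ condensateOccupation N L Ψ.ψ) →
        ∀ ε : ℝ, 0 < ε → ∃ δ : ℝ≥0∞, 0 < δ ∧ ∀ Φ : PeriodicTrialState N L,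
          periodicEnergy v Φ ≤ periodicGroundStateEnergy v N L + δ →
          ENNReal.ofReal ((c - ε) * N) ≤ condensateOccupation N L Φ.ψ

/-- Sanity: the crux is literally `A → conjunct`; both cards discharge it by proving the conjunct's
periodic form on the FULL class and then using the shared crux `BoundaryTransferWeak` per potential.
This records the shape of that last step (pure logic over the route decls). -/
theorem hardCoreExtension_of_periodicBEC_all
    (hper : ∀ v : ℝ → ℝ≥0∞, IsRepulsiveFiniteRange v →
      ∃ ρ₀ : ℝ, 0 < ρ₀ ∧ ∀ ρ : ℝ, 0 < ρ → ρ < ρ₀ → ∃ c : ℝ, 0 < c ∧ ∀ᶠ N : ℕ in atTop,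
        ∃ δ : ℝ≥0∞, 0 < δ ∧ ∀ Ψ : PeriodicTrialState N (sideLength ρ N),
          periodicEnergy v Ψ ≤ periodicGroundStateEnergy v N (sideLength ρ N) + δ →
          ENNReal.ofReal (c * N) ≤ condensateOccupation N (sideLength ρ N) Ψ.ψ)
    (hbt : Theses.BECConjugateDomination.BoundaryTransferWeak) :
    Theses.BECConjugateDomination.HardCoreExtension := by
  intro _hA v hv
  exact hbt v hv (hper v hv)

end Summit.AtomisticToContinuum.BoseEinsteinCondensation.Cruxes.HardCoreExtension.Ideator3
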